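import Literature.AlgebraicGeometry.Frobenioids.ArithmeticDivisorsFunctor
import Literature.AlgebraicGeometry.Frobenioids.FinSubextCat
import Literature.AlgebraicGeometry.Frobenioids.ModelFrobenioid
import Literature.AlgebraicGeometry.Frobenioids.PreFrobenioidDataOfModel
import HarnessLib

/-!
# Frobenioids I, Example 6.3 / Theorem 6.4: the arithmetic model Frobenioid `C_{K/F}` — CONSTRUCTION

Mochizuki, *The geometry of Frobenioids I*, Kyushu J. Math. **62** (2008), Example 6.3, kurims p. 113:
with `Φ : L ↦ Φ(L)` (effective arithmetic divisors), `B : L ↦ L^×` and the natural homomorphism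
`B(L) → Φ(L)^gp` ("`Φ`, `B`, as well as `B → Φ^gp` are functorial"), "we may apply Theorem 5.2, (ii), to
conclude the existence of a Frobenioid `C_{F̃/F}`"; Theorem 6.4, p. 114: "`C_i` the associated model
Frobenioid of Theorem 5.2, (ii)". [cite: MochizukiFrdI2008, Ex. 6.3 p.113]

CONSTRUCTED here (seat abc-iut-L6-t10, "Ex. 6.3 construction binding"), over abc-iut-L1-t3's
`FinSubextCat` (`D = B(Gal(K/F))⁰`) and `ArithmeticDivisors`, abc-iut-L1-t2's `ModelFrobenioid`
(Thm. 5.2 (i)) and the pull-backs of `ArithmeticDivisorsFunctor.lean`: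
* `EffArithDivisor.gpEquiv L : Φ(L)^gp ≃* Φ(L)^gp_concrete` — the groupification of the monoid of effective
  arithmetic divisors IS the group `ArithDivisor L` of `ArithmeticDivisors.lean` (`Φ → Φ^gp` injective and
  every arithmetic divisor a difference of effective ones), naturally in `L` (`gpHom_map`);
* `arithDivisorFunctor F K : Dᵒᵖ ⥤ CommMonCat` — the monoid `Φ` on `D` (Def. 1.1 (ii) encoding of this
  directory), `Spec L ↦ Φ(L)`, arrows ↦ pull-back; `unitsFunctor F K` — `B : Spec L ↦ L^×`;
* `divNatTrans F K : B ⟶ Φ^gp` — `f ↦ div(f)`, a homomorphism of monoids on `D` (naturality =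
  `σ^* div(f) = div(σ f)`);
* `arithFrobenioid F K := ModelFrobenioid Φ B Div_B` — THE category `C_{K/F}` of Thm. 6.4, with operations
  `arithFrobenioidOps F K := PreFrobenioidData.ofModel …` (Thm. 5.2 (i), last sentence).
The packaging as abc-iut-L1-t3's `ArithModelFrobenioid F K (arithFrobenioid F K)` lives in the companion of
`ArithmeticFrobenioids.lean`. Nothing here asserts anything about abc.
-/

noncomputable section

namespace Literature.AlgebraicGeometry.Frobenioids

open CategoryTheory Opposite NumberField

/-! ### `Φ(L)^gp = ArithDivisor L` -/

section Gp

universe u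

variable (L : Type u) [Field L] [NumberField L]

/-- The comparison `Φ(L)^gp → ArithDivisor L`: the group homomorphism from the groupification of the monoid
of effective arithmetic divisors to the group of arithmetic divisors extending `Φ ⊆ Φ^gp`.
[cite: MochizukiFrdI2008, Ex. 6.3 p.113] -/
def EffArithDivisor.gpHom :
    Algebra.GrothendieckGroup (Multiplicative (EffArithDivisor L)) →* Multiplicative (ArithDivisor L) :=
  Algebra.GrothendieckGroup.lift (AddMonoidHom.toMultiplicative (EffArithDivisor.toArithDivisor L))

/-- `gpHom` extends the inclusion `Φ ⊆ Φ^gp`. [cite: MochizukiFrdI2008, Ex. 6.3 p.113] -/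
@[simp] theorem EffArithDivisor.gpHom_of (D : Multiplicative (EffArithDivisor L)) :
    EffArithDivisor.gpHom L (Algebra.GrothendieckGroup.of D) =
      Multiplicative.ofAdd (EffArithDivisor.toArithDivisor L (Multiplicative.toAdd D)) := by
  have h := Algebra.GrothendieckGroup.lift.symm_apply_apply
    (AddMonoidHom.toMultiplicative (EffArithDivisor.toArithDivisor L))
  rw [Algebra.GrothendieckGroup.lift_symm_apply] at h
  exact DFunLike.congr_fun h D

/-- Elements of a Grothendieck group are quotients of elements of the monoid. [folklore] -/
private theorem mk_eq_of_div_of {M : Type*} [CommMonoid M] (m : M) (s : (⊤ : Submonoid M)) :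
    (Localization.mk m s : Algebra.GrothendieckGroup M) =
      Algebra.GrothendieckGroup.of m / Algebra.GrothendieckGroup.of (s : M) := by
  rw [show Algebra.GrothendieckGroup.of m = Localization.mk m 1 from rfl,
    show Algebra.GrothendieckGroup.of (s : M) = Localization.mk (s : M) 1 from rfl,
    Algebra.GrothendieckGroup.mk_div_mk]
  congr 1
  · exact (mul_one m).symm
  · exact Subtype.ext (one_mul _).symm

/-- `gpHom` is bijective: injective because `Φ(L)` is cancellative and embeds in `ArithDivisor L`,
surjective because every arithmetic divisor is a difference of effective ones.
[cite: MochizukiFrdI2008, Ex. 6.3 p.113] -/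
theorem EffArithDivisor.gpHom_bijective : Function.Bijective (EffArithDivisor.gpHom L) := by
  constructor
  · refine (injective_iff_map_eq_one _).mpr fun x hx => ?_
    induction x using Localization.induction_on with
    | H y =>
      obtain ⟨m, s⟩ := y
      rw [mk_eq_of_div_of] at hx ⊢
      rw [map_div, div_eq_one, EffArithDivisor.gpHom_of, EffArithDivisor.gpHom_of] at hx
      have h := EffArithDivisor.toArithDivisor_injective L (Multiplicative.ofAdd.injective hx)
      rw [show m = (s : Multiplicative (EffArithDivisor L)) from Multiplicative.toAdd.injective h, div_self']
  · intro d
    obtain ⟨D, E, h⟩ := ArithDivisor.exists_sub_eq L (Multiplicative.toAdd d)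
    refine ⟨Algebra.GrothendieckGroup.of (Multiplicative.ofAdd D) /
      Algebra.GrothendieckGroup.of (Multiplicative.ofAdd E), ?_⟩
    rw [map_div, EffArithDivisor.gpHom_of, EffArithDivisor.gpHom_of, toAdd_ofAdd, toAdd_ofAdd,
      ← ofAdd_sub, h, ofAdd_toAdd]

/-- **`Φ(L)^gp ≅ ⊕_v ord(L_v)`** (FrdI Ex. 6.3 p. 113: "`Φ(F)^gp = ⊕_{v ∈ V(F)} ord(F_v)`"): the
groupification of the effective arithmetic divisors is the group of arithmetic divisors.
[cite: MochizukiFrdI2008, Ex. 6.3 p.113] -/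
def EffArithDivisor.gpEquiv :
    Algebra.GrothendieckGroup (Multiplicative (EffArithDivisor L)) ≃* Multiplicative (ArithDivisor L) :=
  MulEquiv.ofBijective (EffArithDivisor.gpHom L) (EffArithDivisor.gpHom_bijective L)

/-- `gpEquiv` is `gpHom`. [cite: MochizukiFrdI2008, Ex. 6.3 p.113] -/
@[simp] theorem EffArithDivisor.gpEquiv_apply (x : Algebra.GrothendieckGroup (Multiplicative (EffArithDivisor L))) :
    EffArithDivisor.gpEquiv L x = EffArithDivisor.gpHom L x := rfl

variable {L} {M : Type u} [Field M] [NumberField M]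

/-- Naturality of `Φ^gp = ArithDivisor` with respect to pull-backs: `(σ^*)^gp` corresponds to the pull-back
of arithmetic divisors. [cite: MochizukiFrdI2008, Ex. 6.3 p.113] -/
theorem EffArithDivisor.gpHom_map (σ : M →+* L)
    (x : Algebra.GrothendieckGroup (Multiplicative (EffArithDivisor M))) :
    EffArithDivisor.gpHom L (MonGp.map (AddMonoidHom.toMultiplicative (EffArithDivisor.pullback σ)) x) =
      AddMonoidHom.toMultiplicative (ArithDivisor.pullback σ) (EffArithDivisor.gpHom M x) := by
  have key : (EffArithDivisor.gpHom L).comp (MonGp.map (AddMonoidHom.toMultiplicative (EffArithDivisor.pullback σ))) =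
      (AddMonoidHom.toMultiplicative (ArithDivisor.pullback σ)).comp (EffArithDivisor.gpHom M) := by
    refine MonGp.hom_ext fun a => ?_
    rw [MonoidHom.comp_apply, MonoidHom.comp_apply, MonGp.map_of, EffArithDivisor.gpHom_of,
      EffArithDivisor.gpHom_of]
    exact congrArg Multiplicative.ofAdd (EffArithDivisor.toArithDivisor_pullback σ (Multiplicative.toAdd a))
  exact DFunLike.congr_fun key x

end Gp

/-! ### The monoids `Φ`, `B` on `D` and `Div_B : B → Φ^gp` -/

section Functors

variable (F : Type) [Field F] [NumberField F] (K : Type) [Field K] [Algebra F K]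

/-- **The divisor monoid `Φ` of Example 6.3 on `D = B(Gal(K/F))⁰`** (FrdI p. 113): `Spec L ↦ Φ(L)`
(effective arithmetic divisors), an arrow `Spec L → Spec M` ↦ the pull-back `Φ(M) → Φ(L)`; a monoid on `D`
in the sense of Def. 1.1 (ii) (`Dᵒᵖ ⥤ CommMonCat`). [cite: MochizukiFrdI2008, Ex. 6.3 p.113] -/
def arithDivisorFunctor : (FinSubextCat F K)ᵒᵖ ⥤ CommMonCat.{0} where
  obj X := CommMonCat.of (Multiplicative (EffArithDivisor X.unop.L))
  map f := CommMonCat.ofHom (AddMonoidHom.toMultiplicative (EffArithDivisor.pullback f.unop.toAlgHom.toRingHom))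
  map_id X := by
    apply CommMonCat.hom_ext
    rw [CommMonCat.hom_ofHom, CommMonCat.hom_id]
    refine MonoidHom.ext fun x => ?_
    exact congrArg Multiplicative.ofAdd (EffArithDivisor.pullback_id (Multiplicative.toAdd x))
  map_comp f g := by
    apply CommMonCat.hom_ext
    rw [CommMonCat.hom_ofHom, CommMonCat.hom_comp, CommMonCat.hom_ofHom, CommMonCat.hom_ofHom]
    refine MonoidHom.ext fun x => ?_
    exact congrArg Multiplicative.ofAdd (EffArithDivisor.pullback_comp _ _ (Multiplicative.toAdd x))

/-- **The rational function monoid `B` of Example 6.3 on `D`** (FrdI p. 113): `Spec L ↦ L^×`, arrows ↦ the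
induced maps of units. [cite: MochizukiFrdI2008, Ex. 6.3 p.113] -/
def unitsFunctor : (FinSubextCat F K)ᵒᵖ ⥤ CommMonCat.{0} where
  obj X := CommMonCat.of (X.unop.L)ˣ
  map f := CommMonCat.ofHom (Units.map (f.unop.toAlgHom : _ →* _))
  map_id X := by
    apply CommMonCat.hom_ext
    rw [CommMonCat.hom_ofHom, CommMonCat.hom_id]
    refine MonoidHom.ext fun u => Units.ext ?_
    rfl
  map_comp f g := by
    apply CommMonCat.hom_ext
    rw [CommMonCat.hom_ofHom, CommMonCat.hom_comp, CommMonCat.hom_ofHom, CommMonCat.hom_ofHom]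
    refine MonoidHom.ext fun u => Units.ext ?_
    rfl

/-- **`B → Φ^gp`**, the natural homomorphism `f ↦ div(f)` of Example 6.3 (FrdI p. 113) as a homomorphism of
monoids on `D`; naturality is `σ^* div(f) = div(σ f)` (`ArithDivisor.pullback_principalArithDivisor`).
[cite: MochizukiFrdI2008, Ex. 6.3 p.113] -/
def divNatTrans : unitsFunctor F K ⟶ monoidGp (arithDivisorFunctor F K) where
  app X := CommMonCat.ofHom
    ((EffArithDivisor.gpEquiv X.unop.L).symm.toMonoidHom.comp (principalArithDivisorHom X.unop.L))
  naturality X Y f := by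
    apply CommMonCat.hom_ext
    refine MonoidHom.ext fun u => ?_
    change (EffArithDivisor.gpEquiv Y.unop.L).symm
        (principalArithDivisorHom Y.unop.L (Units.map (f.unop.toAlgHom : _ →* _) u)) =
      MonGp.map (AddMonoidHom.toMultiplicative (EffArithDivisor.pullback f.unop.toAlgHom.toRingHom))
        ((EffArithDivisor.gpEquiv X.unop.L).symm (principalArithDivisorHom X.unop.L u))
    apply (EffArithDivisor.gpEquiv Y.unop.L).injective
    rw [MulEquiv.apply_symm_apply, EffArithDivisor.gpEquiv_apply, EffArithDivisor.gpHom_map,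
      ← EffArithDivisor.gpEquiv_apply, MulEquiv.apply_symm_apply]
    exact (congrArg Multiplicative.ofAdd
      (ArithDivisor.pullback_principalArithDivisor f.unop.toAlgHom.toRingHom u)).symm

/-- **The arithmetic model Frobenioid `C_{K/F}`** of Example 6.3 / Theorem 6.4 (FrdI pp. 113–114): the model
Frobenioid of Thm. 5.2 (i) (`ModelFrobenioid`, seat abc-iut-L1-t2) of the data `(Φ, B, B → Φ^gp)` over
`D = B(Gal(K/F))⁰`. [cite: MochizukiFrdI2008, Thm. 6.4 p.114] -/
abbrev arithFrobenioid : Type :=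
  ModelFrobenioid (arithDivisorFunctor F K) (unitsFunctor F K) (divNatTrans F K)

/-- The operations `(Base, Div, deg_Fr)` of `C_{K/F}` over `D` (Thm. 5.2 (i), last sentence; abc-iut-L1-t3's
`PreFrobenioidData.ofModel`). [cite: MochizukiFrdI2008, Thm. 6.4 p.114] -/
abbrev arithFrobenioidOps : PreFrobenioidData.{0} (arithFrobenioid F K) (FinSubextCat F K) :=
  PreFrobenioidData.ofModel (arithDivisorFunctor F K) (unitsFunctor F K) (divNatTrans F K)

/-- The divisor monoid of `C_{K/F}` at `Spec L` is (literally) `Φ(L)`. [cite: MochizukiFrdI2008, Thm. 6.4 p.114] -/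
theorem arithFrobenioidOps_mon (X : FinSubextCat F K) :
    (arithFrobenioidOps F K).Mon X = Multiplicative (EffArithDivisor X.L) := rfl

end Functors

end Literature.AlgebraicGeometry.Frobenioids

end
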